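import Literature.NumberTheory.DiophantineGeometry.BertiniSpecializationProofs
import Literature.NumberTheory.DiophantineGeometry.BertiniWeightedResultantProofs
import Mathlib.FieldTheory.IsAlgClosed.Basic
import Mathlib.FieldTheory.Separable
import HarnessLib

/-!
# The certificate `Υ_D(Z)` excluding factors of degree `≤ D` of a generic plane section
(Cafure–Matera's Theorem 3.3)

Let `E` be an algebraically closed field, `χ ∈ E[Z][Y][X]` (outer `X`, inner `Y`,
`E[Z] = MvPolynomial (Fin n) E`) irreducible of `X`-degree `δ` with nonzero constant leading
coefficient, total degree `δ` in `(X, Y)`, coefficients of `Xᵉ Yʲ` of `Z`-degree `≤ j`, and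
reduction `χ(X, 0, Z) = g(X)` with `g ∈ E[X]` separable. For `1 ≤ D < δ` there is a nonzero
`Υ_D ∈ E[Z]` of total degree `≤ δ (D+1)² 2Dδ` such that for every `γ ∈ Eⁿ` with `Υ_D(γ) ≠ 0` the
specialised section `χ(X, Y, γ) ∈ E[Y][X]` has **no factor `P` of positive `X`-degree with
`deg_X P ≤ D` and `X`-coefficients of `Y`-degree `≤ D`** — in particular no irreducible factor of
total degree `≤ D` (`exists_noSmallFactor_certificate`). This is Cafure–Matera's variant
(2006, Thm. 3.3) of Kaltofen's effective Hilbert irreducibility theorem, with the cruder degree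
bound `δ (D+1)² 2Dδ` (a full box of `(D+1)²` unknown coefficients and the row-count bound for a
maximal minor) in place of the printed `Dδ²(D+1)(D+2) - (D²+3D)(D²+3D+2)δ/8`.

Proof, following the printed one with the tree's Kaltofen machinery
(`BertiniSpecializationProofs` and its imports): for each of the `≤ δ` roots `α` of `g` (all
simple), Newton–Hensel lifting gives a truncated root `a_α ∈ E[Z][Y]`, `χ(a_α) ≡ 0 mod Y^{2κ}`,
`κ = 2Dδ + 1`, inside the degree filtration; the `E[Z]`-matrix of
`h ↦ (first κ Y-coefficients of h(a_α))` on the box-small `h = ∑_{e,j ≤ D} w_{ej} Xᵉ Yʲ` has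
independent columns by the two-weight resultant argument (`eq_zero_of_pow_dvd_eval_two_weights`:
`Res_X^{δ,D}(χ, h)` has `Y`-degree `≤ Dδ + δD < κ`), hence a nonzero maximal minor `Υ_α` of degree
`≤ (D+1)² (κ - 1)`; put `Υ_D = ∏_α Υ_α`. If `Υ_D(γ) ≠ 0` and `χ(X, Y, γ) = P Q` with `P` box-small
of positive `X`-degree, pick a root `α` of `P(X, 0)`; it is a simple root of `g = P(X,0) Q(X,0)`,
so `Q(a_α(γ)) ≢ 0 mod Y` and `Y^{2κ} ∣ P(a_α(γ)) Q(a_α(γ))` forces `Y^{2κ} ∣ P(a_α(γ))`; as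
`Υ_α(γ) ≠ 0` the specialised matrix is injective and `P = 0`, a contradiction.

No definitions, no new named facts.

## References

* A. Cafure, G. Matera, *Improved explicit estimates on the number of solutions of equations over
  a finite field*, Finite Fields Appl. 12 (2006) 155–185, §3.1–3.2, Thm. 3.3 and its proof.
  [CafureMatera2006]
* E. Kaltofen, *Effective Noether irreducibility forms and applications*, J. Comput. System Sci.
  50 (1995) 274–295, §3, Thm. 5. [Kaltofen1995]
-/

noncomputable section

open scoped Classical Polynomial Polynomial.Bivariate
open Polynomial

namespace Literature.NumberTheory.DiophantineGeometry

universe u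

variable {E : Type u} [Field E] {n : ℕ}

/-! ### Reduction modulo `Y` commutes with specialisation -/

/-- `(χ(X, Y, γ))(X, 0) = g` when `χ(X, 0, Z) = g`. [folklore] -/
theorem map_evalRingHom_zero_map_mapRingHom_eval
    (χ : Polynomial (Polynomial (MvPolynomial (Fin n) E))) (γ : Fin n → E) {g : E[X]}
    (hred : χ.map (evalRingHom 0) = g.map (MvPolynomial.C : E →+* MvPolynomial (Fin n) E)) :
    (χ.map (mapRingHom (MvPolynomial.eval γ))).map (evalRingHom 0) = g := by
  have hcomp : (evalRingHom (0 : E)).comp (mapRingHom (MvPolynomial.eval γ)) =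
      (MvPolynomial.eval γ).comp (evalRingHom (0 : MvPolynomial (Fin n) E)) := by
    refine RingHom.ext fun p ↦ ?_
    simp only [RingHom.coe_comp, Function.comp_apply, coe_evalRingHom, coe_mapRingHom]
    rw [← coeff_zero_eq_eval_zero, ← coeff_zero_eq_eval_zero, coeff_map]
  rw [Polynomial.map_map, hcomp, ← Polynomial.map_map, hred, Polynomial.map_map]
  have : (MvPolynomial.eval γ).comp (MvPolynomial.C : E →+* MvPolynomial (Fin n) E) =
      RingHom.id E := RingHom.ext fun x ↦ by simp
  rw [this, Polynomial.map_id]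

/-- `(Q(a))(0) = Q(X, 0)(a(0))` for `Q ∈ E[Y][X]`, `a ∈ E[Y]`. [folklore] -/
theorem coeff_zero_eval_eq (Q : E[X][Y]) (a : E[X]) :
    (Q.eval a).coeff 0 = (Q.map (evalRingHom 0)).eval (a.coeff 0) := by
  have h := Polynomial.hom_eval₂ Q (RingHom.id E[X]) (evalRingHom (0 : E)) a
  rw [eval₂_id, RingHom.comp_id] at h
  rw [coeff_zero_eq_eval_zero, ← coe_evalRingHom, h, eval_map, coe_evalRingHom,
    coeff_zero_eq_eval_zero]

/-! ### The certificate at one simple root (box-small annihilators, precision `2Dδ + 1`) -/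

section OneRoot

/-- **The minor `Υ_α` at a simple root `α` of `χ(X, 0, Z)`** (Cafure–Matera, proof of Thm. 3.3,
for one root `ζ_i`; Kaltofen's Thm. 5 with order of approximation `2D`). With `κ = 2Dδ + 1` there
are a truncated root `a ≡ α mod Y` of `χ` to precision `Y^{2κ}` and `0 ≠ Υ ∈ E[Z]` of total degree
`≤ (D+1)² (2Dδ)` such that, whenever `Υ(γ) ≠ 0`, no nonzero `P ∈ E[Y][X]` with `deg_X P ≤ D` and
`X`-coefficients of `Y`-degree `≤ D` has `Y^κ ∣ P(a(γ))`.
[cite: CafureMatera2006, proof of Thm. 3.3] [cite: Kaltofen1995, Thm. 5] -/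
theorem exists_root_minor {χ : Polynomial (Polynomial (MvPolynomial (Fin n) E))}
    {δ D : ℕ} (hDδ : D + 1 ≤ δ) (hdeg : χ.natDegree = δ) {c : E} (hc : c ≠ 0)
    (hlead : χ.leadingCoeff = C (MvPolynomial.C c)) (hirr : Irreducible χ)
    (htd : ∀ e j, δ < j + e → (χ.coeff e).coeff j = 0)
    (hfil : ∀ e j, ((χ.coeff e).coeff j).totalDegree ≤ j)
    {g : E[X]}
    (hred : χ.map (evalRingHom 0) = g.map (MvPolynomial.C : E →+* MvPolynomial (Fin n) E))
    {α : E} (hα : g.eval α = 0) (hα' : (derivative g).eval α ≠ 0) :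
    ∃ (a : Polynomial (MvPolynomial (Fin n) E)) (Υ : MvPolynomial (Fin n) E),
      (X : Polynomial (MvPolynomial (Fin n) E)) ∣ a - C (MvPolynomial.C α) ∧
      (X : Polynomial (MvPolynomial (Fin n) E)) ^ (2 * (2 * D * δ + 1)) ∣ χ.eval a ∧
      Υ ≠ 0 ∧ Υ.totalDegree ≤ (D + 1) ^ 2 * (2 * D * δ) ∧
      ∀ γ : Fin n → E, MvPolynomial.eval γ Υ ≠ 0 →
        ∀ P : E[X][Y], P.natDegree ≤ D → (∀ e, (P.coeff e).natDegree ≤ D) →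
          (X : E[X]) ^ (2 * D * δ + 1) ∣ P.eval (a.map (MvPolynomial.eval γ)) → P = 0 := by
  set κ : ℕ := 2 * D * δ + 1 with hκ
  have hδ : 1 ≤ δ := le_trans (Nat.succ_le_succ (Nat.zero_le D)) hDδ
  have hD1 : 1 ≤ D + 1 := Nat.succ_le_succ (Nat.zero_le D)
  -- consequences of the shape hypotheses
  have hχc : ∀ i, (χ.coeff i).natDegree ≤ δ := fun i ↦ by
    rw [natDegree_le_iff_coeff_eq_zero]
    intro j hj
    exact htd i j (by omega)
  have hχu : IsUnit χ.leadingCoeff := by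
    rw [hlead]
    exact isUnit_C.2 ((IsUnit.mk0 c hc).map MvPolynomial.C)
  -- Step 1: a truncated root by Newton–Hensel lifting, inside the degree filtration
  set u : E := ((derivative g).eval α)⁻¹ with hu
  have hroot0 : (X : Polynomial (MvPolynomial (Fin n) E)) ∣ χ.eval (C (MvPolynomial.C α)) := by
    refine X_dvd_eval_C_of_eval_eq_zero χ ?_
    rw [hred, eval_map, eval₂_at_apply, hα, map_zero]
  have hunit0 : (X : Polynomial (MvPolynomial (Fin n) E)) ∣
      1 - C (MvPolynomial.C u) * (derivative χ).eval (C (MvPolynomial.C α)) := by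
    refine X_dvd_one_sub_of_eval_derivative χ ?_
    rw [hred, derivative_map, eval_map, eval₂_at_apply, ← map_mul, hu, inv_mul_cancel₀ hα', map_one]
  obtain ⟨a, haS, hamod, haroot⟩ := exists_approxRoot_of_invariant χ (MvPolynomial.C α)
    (MvPolynomial.C u) {a | ∀ j, (a.coeff j).totalDegree ≤ j} (filtrationY_C_C α)
    (fun a ha ↦ filtrationY_newton_step hfil u ha) hroot0 hunit0 (2 * κ - 1)
  rw [show 2 * κ - 1 + 1 = 2 * κ by omega] at haroot
  have haS' : ∀ j, (a.coeff j).totalDegree ≤ j := haS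
  have haroot' : (X : Polynomial (MvPolynomial (Fin n) E)) ^ κ ∣ χ.eval a :=
    (pow_dvd_pow _ (by omega)).trans haroot
  -- Step 2: the matrix of `w ↦ (h_w(a))_{k<κ}` on box-small `h` has independent columns
  set M : Matrix (Fin κ) (Fin (D + 1) × Fin (D + 1)) (MvPolynomial (Fin n) E) :=
    Matrix.of fun k p ↦ (X ^ (p.2 : ℕ) * a ^ (p.1 : ℕ)).coeff k with hM
  have hcols : LinearIndependent (MvPolynomial (Fin n) E) M.col := by
    rw [Fintype.linearIndependent_iff]
    intro w hw p
    set h : Polynomial (Polynomial (MvPolynomial (Fin n) E)) :=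
      ∑ e' : Fin (D + 1), C (∑ j' : Fin (D + 1), C (w (e', j')) * X ^ (j' : ℕ)) * X ^ (e' : ℕ)
      with hh
    have hk : ∀ k : Fin κ, (h.eval a).coeff k = 0 := fun k ↦ by
      rw [hh, coeff_eval_small]
      have := congrFun hw k
      simp only [Finset.sum_apply, Pi.smul_apply, smul_eq_mul, Pi.zero_apply, Matrix.col_apply,
        hM, Matrix.of_apply] at this
      rw [← this]
    have hdvd : (X : Polynomial (MvPolynomial (Fin n) E)) ^ κ ∣ h.eval a := by
      rw [X_pow_dvd_iff]
      intro d hd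
      exact hk ⟨d, hd⟩
    have h0 : h = 0 :=
      eq_zero_of_pow_dvd_eval_two_weights (δ := δ) (D := D) (d := δ) (d' := D) (κ := κ)
        hδ hdeg hχu hirr hχc hDδ
        ((natDegree_sum_C_mul_X_pow_le _ hD1).trans (by omega))
        (fun i ↦ (natDegree_coeff_small_le w hD1 i).trans (by omega))
        (by rw [hκ]; ring_nf; omega) haroot' hdvd
    have := coeff_coeff_small w p.1 p.2
    rw [← hh, h0, coeff_zero, coeff_zero] at this
    exact this.symm
  -- Step 3: degrees of the entries and a nonzero maximal minor
  have hMdeg : ∀ k p, (M k p).totalDegree ≤ (k : ℕ) := by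
    intro k p
    rw [hM, Matrix.of_apply, coeff_X_pow_mul']
    split_ifs with hle
    · exact (filtrationY_pow haS' _ _).trans (Nat.sub_le _ _)
    · rw [MvPolynomial.totalDegree_zero]; exact Nat.zero_le _
  obtain ⟨f, hf, hdet, hdegΥ⟩ := exists_det_submatrix_ne_zero_totalDegree_le M hcols hMdeg
  -- (realign the `DecidableEq` instance hidden in `det`)
  have hdet' : (M.submatrix f id).det ≠ 0 := by convert hdet
  have hdegΥ' : (M.submatrix f id).det.totalDegree ≤
      Fintype.card (Fin (D + 1) × Fin (D + 1)) * (κ - 1) := by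
    convert hdegΥ
  refine ⟨a, (M.submatrix f id).det, hamod, haroot, hdet', ?_, fun γ hγ P hPdeg hPc hPdvd ↦ ?_⟩
  · refine hdegΥ'.trans (le_of_eq ?_)
    rw [Fintype.card_prod, Fintype.card_fin, hκ, Nat.add_sub_cancel, pow_two]
  -- Step 4: specialisation at `γ` with `Υ(γ) ≠ 0`: the specialised matrix is injective
  set φ : MvPolynomial (Fin n) E →+* E := MvPolynomial.eval γ with hφ
  set a₀ : E[X] := a.map φ with ha₀
  set w₀ : Fin (D + 1) × Fin (D + 1) → E := fun p ↦ (P.coeff p.1).coeff p.2 with hw₀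
  have hP : P = ∑ e' : Fin (D + 1),
      C (∑ j' : Fin (D + 1), C (w₀ (e', j')) * X ^ (j' : ℕ)) * X ^ (e' : ℕ) :=
    eq_small_of_natDegree_le hD1 (by omega) (fun e ↦ (hPc e).trans (by omega))
  have hentry : ∀ (k : ℕ) (p : Fin (D + 1) × Fin (D + 1)),
      (X ^ (p.2 : ℕ) * a₀ ^ (p.1 : ℕ) : E[X]).coeff k =
        φ ((X ^ (p.2 : ℕ) * a ^ (p.1 : ℕ)).coeff k) := by
    intro k p
    rw [← coeff_map, Polynomial.map_mul, Polynomial.map_pow, Polynomial.map_pow, map_X]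
  have hmul : ((M.submatrix f id).map φ).mulVec w₀ = 0 := by
    funext i
    rw [Matrix.mulVec, Pi.zero_apply, dotProduct]
    have hk : (P.eval a₀).coeff (f i) = 0 := by
      rw [X_pow_dvd_iff] at hPdvd
      exact hPdvd _ (f i).2
    rw [hP, coeff_eval_small] at hk
    rw [← hk]
    refine Finset.sum_congr rfl fun p _ ↦ ?_
    rw [Matrix.map_apply, Matrix.submatrix_apply, hM, Matrix.of_apply, id, hentry, mul_comm]
  have hdet0 : ((M.submatrix f id).map φ).det ≠ 0 := by
    rw [← RingHom.mapMatrix_apply, ← RingHom.map_det]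
    exact hγ
  have hw0 : w₀ = 0 := Matrix.eq_zero_of_mulVec_eq_zero hdet0 hmul
  rw [hP, hw0]
  simp

end OneRoot

/-! ### The certificate `Υ_D = ∏_α Υ_α` -/

/-- **Cafure–Matera's Theorem 3.3 (certificate excluding factors of degree `≤ D`).** Let `E` be
algebraically closed, `χ ∈ E[Z][Y][X]` irreducible of `X`-degree `δ` with leading coefficient the
nonzero constant `c`, of total degree `≤ δ` in `(X, Y)`, with the coefficient of `Xᵉ Yʲ` of
`Z`-degree `≤ j`, and with `χ(X, 0, Z) = g(X)`, `g ∈ E[X]` separable. For `1 ≤ D`, `D + 1 ≤ δ`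
there is `Υ ∈ E[Z]`, `Υ ≠ 0`, of total degree `≤ δ ((D+1)² (2Dδ))`, such that whenever `Υ(γ) ≠ 0`
the specialised section `χ(X, Y, γ)` admits no factorisation `P Q` with `1 ≤ deg_X P ≤ D` and all
`X`-coefficients of `P` of `Y`-degree `≤ D` (so no irreducible factor of total degree `≤ D`).
(Printed bound: `Dδ²(D+1)(D+2) - (D²+3D)(D²+3D+2)δ/8`, for the triangle of `(D+1)(D+2)/2 - 1`
unknowns and distinct pivot rows; here the full box and the row-count bound.)
[cite: CafureMatera2006, Thm. 3.3] [cite: Kaltofen1995, Thm. 5] -/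
theorem exists_noSmallFactor_certificate [IsAlgClosed E]
    {χ : Polynomial (Polynomial (MvPolynomial (Fin n) E))}
    {δ D : ℕ} (hDδ : D + 1 ≤ δ) (hdeg : χ.natDegree = δ) {c : E} (hc : c ≠ 0)
    (hlead : χ.leadingCoeff = C (MvPolynomial.C c)) (hirr : Irreducible χ)
    (htd : ∀ e j, δ < j + e → (χ.coeff e).coeff j = 0)
    (hfil : ∀ e j, ((χ.coeff e).coeff j).totalDegree ≤ j)
    {g : E[X]}
    (hred : χ.map (evalRingHom 0) = g.map (MvPolynomial.C : E →+* MvPolynomial (Fin n) E))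
    (hsep : g.Separable) :
    ∃ Υ : MvPolynomial (Fin n) E, Υ ≠ 0 ∧ Υ.totalDegree ≤ δ * ((D + 1) ^ 2 * (2 * D * δ)) ∧
      ∀ γ : Fin n → E, MvPolynomial.eval γ Υ ≠ 0 →
        ∀ P Q : E[X][Y], χ.map (mapRingHom (MvPolynomial.eval γ)) = P * Q →
          1 ≤ P.natDegree → P.natDegree ≤ D → (∀ e, (P.coeff e).natDegree ≤ D) → False := by
  set κ : ℕ := 2 * D * δ + 1 with hκ
  have hδ : 1 ≤ δ := le_trans (Nat.succ_le_succ (Nat.zero_le D)) hDδ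
  -- `g` has degree `δ` (its `X^δ`-coefficient is `c`)
  have hgcoeff : g.coeff δ = c := by
    have h1 := congrArg (fun p ↦ Polynomial.coeff p δ) hred
    simp only [coeff_map, coe_evalRingHom] at h1
    rw [← hdeg, coeff_natDegree, hlead, hdeg, eval_C] at h1
    exact (MvPolynomial.C_injective _ _ h1).symm
  have hg0 : g ≠ 0 := fun h ↦ hc (by rw [← hgcoeff, h, coeff_zero])
  have hgdeg : g.natDegree ≤ δ := by
    rw [natDegree_le_iff_coeff_eq_zero]
    intro m hm
    have h1 := congrArg (fun p ↦ Polynomial.coeff p m) hred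
    simp only [coeff_map, coe_evalRingHom] at h1
    rw [coeff_eq_zero_of_natDegree_lt (by rw [hdeg]; exact_mod_cast hm), eval_zero] at h1
    exact MvPolynomial.C_injective _ _ (by rw [← h1, MvPolynomial.C_0])
  -- the per-root minors
  set R : Finset E := g.roots.toFinset with hR
  have hRcard : R.card ≤ δ :=
    (Multiset.toFinset_card_le _).trans ((card_roots' g).trans hgdeg)
  have hex : ∀ α ∈ R, ∃ (a : Polynomial (MvPolynomial (Fin n) E)) (Υ : MvPolynomial (Fin n) E),
      (X : Polynomial (MvPolynomial (Fin n) E)) ∣ a - C (MvPolynomial.C α) ∧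
      (X : Polynomial (MvPolynomial (Fin n) E)) ^ (2 * κ) ∣ χ.eval a ∧
      Υ ≠ 0 ∧ Υ.totalDegree ≤ (D + 1) ^ 2 * (2 * D * δ) ∧
      ∀ γ : Fin n → E, MvPolynomial.eval γ Υ ≠ 0 →
        ∀ P : E[X][Y], P.natDegree ≤ D → (∀ e, (P.coeff e).natDegree ≤ D) →
          (X : E[X]) ^ κ ∣ P.eval (a.map (MvPolynomial.eval γ)) → P = 0 := by
    intro α hαR
    rw [hR, Multiset.mem_toFinset, mem_roots hg0, IsRoot.def] at hαR
    have hα' : (derivative g).eval α ≠ 0 := by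
      have := hsep.eval₂_derivative_ne_zero (RingHom.id E) (x := α) (by rw [eval₂_id]; exact hαR)
      rwa [eval₂_id] at this
    exact exists_root_minor hDδ hdeg hc hlead hirr htd hfil hred hαR hα'
  choose! a Υ hamod haroot hΥ0 hΥdeg hΥinj using hex
  refine ⟨∏ α ∈ R, Υ α, Finset.prod_ne_zero_iff.2 fun α hα ↦ hΥ0 α hα, ?_, ?_⟩
  · calc (∏ α ∈ R, Υ α).totalDegree ≤ ∑ α ∈ R, (Υ α).totalDegree :=
          MvPolynomial.totalDegree_finsetProd _ _
      _ ≤ ∑ _α ∈ R, (D + 1) ^ 2 * (2 * D * δ) := Finset.sum_le_sum fun α hα ↦ hΥdeg α hα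
      _ = R.card * ((D + 1) ^ 2 * (2 * D * δ)) := by rw [Finset.sum_const, smul_eq_mul]
      _ ≤ δ * ((D + 1) ^ 2 * (2 * D * δ)) := Nat.mul_le_mul_right _ hRcard
  intro γ hγ P Q hPQ hP1 hPdeg hPc
  have hγ' : ∀ α ∈ R, MvPolynomial.eval γ (Υ α) ≠ 0 := by
    rw [map_prod] at hγ
    exact fun α hα ↦ (Finset.prod_ne_zero_iff.1 hγ) α hα
  -- the specialised section and its shape
  set φ : MvPolynomial (Fin n) E →+* E := MvPolynomial.eval γ with hφ
  set χ₀ : E[X][Y] := χ.map (mapRingHom φ) with hχ₀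
  have hlc : (mapRingHom φ) χ.leadingCoeff = C c := by
    rw [hlead, coe_mapRingHom, Polynomial.map_C, hφ, MvPolynomial.eval_C]
  have hlc0 : (mapRingHom φ) χ.leadingCoeff ≠ 0 := by rw [hlc]; exact C_ne_zero.2 hc
  have hdeg0 : χ₀.natDegree = δ := by
    rw [hχ₀, natDegree_map_of_leadingCoeff_ne_zero _ hlc0, hdeg]
  have hlead0 : χ₀.leadingCoeff = C c := by
    rw [hχ₀, leadingCoeff_map_of_leadingCoeff_ne_zero _ hlc0, hlc]
  have hχ00 : χ₀ ≠ 0 := fun h ↦ by rw [h, natDegree_zero] at hdeg0; omega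
  have hred0 : χ₀.map (evalRingHom 0) = g := map_evalRingHom_zero_map_mapRingHom_eval χ γ hred
  -- the factors
  have hP0 : P ≠ 0 := fun h ↦ hχ00 (by rw [hPQ, h, zero_mul])
  have hQ0 : Q ≠ 0 := fun h ↦ hχ00 (by rw [hPQ, h, mul_zero])
  have hlcPQ : P.leadingCoeff * Q.leadingCoeff = C c := by rw [← leadingCoeff_mul, ← hPQ, hlead0]
  have hPu : IsUnit P.leadingCoeff := isUnit_iff_exists_inv.2 ⟨Q.leadingCoeff * C c⁻¹, by
    rw [← mul_assoc, hlcPQ, ← C_mul, mul_inv_cancel₀ hc, C_1]⟩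
  obtain ⟨p₀, hp₀u, hp₀⟩ := Polynomial.isUnit_iff.1 hPu
  have hp₀0 : p₀ ≠ 0 := hp₀u.ne_zero
  -- the reductions `P(X, 0)`, `Q(X, 0)` and a root `α` of `P(X, 0)`
  set P₀ : E[X] := P.map (evalRingHom 0) with hP₀
  set Q₀ : E[X] := Q.map (evalRingHom 0) with hQ₀
  have hgPQ : g = P₀ * Q₀ := by rw [← hred0, hPQ, Polynomial.map_mul]
  have hlcP : (evalRingHom (0 : E)) P.leadingCoeff ≠ 0 := by
    rw [← hp₀, coe_evalRingHom, eval_C]; exact hp₀0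
  have hP₀deg : P₀.natDegree = P.natDegree := natDegree_map_of_leadingCoeff_ne_zero _ hlcP
  have hP₀deg' : P₀.degree ≠ 0 := by
    intro h0
    have := natDegree_eq_of_degree_eq_some (h0.trans (by rfl : (0 : WithBot ℕ) = ((0 : ℕ) : WithBot ℕ)))
    omega
  obtain ⟨α, hαP⟩ := IsAlgClosed.exists_root P₀ hP₀deg'
  rw [IsRoot.def] at hαP
  have hαg : g.eval α = 0 := by rw [hgPQ, eval_mul, hαP, zero_mul]
  have hαR : α ∈ R := by
    rw [hR, Multiset.mem_toFinset, mem_roots hg0, IsRoot.def]; exact hαg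
  -- `α` is a simple root of `g`, so `Q(α, 0) ≠ 0`
  have hαQ : Q₀.eval α ≠ 0 := by
    intro hQα
    have hder : (derivative g).eval α = 0 := by
      rw [hgPQ, derivative_mul, eval_add, eval_mul, eval_mul, hαP, hQα, mul_zero, zero_mul,
        add_zero]
    have := hsep.eval₂_derivative_ne_zero (RingHom.id E) (x := α) (by rw [eval₂_id]; exact hαg)
    rw [eval₂_id] at this
    exact this hder
  -- the truncated root at `α`, specialised
  set a₀ : E[X] := (a α).map φ with ha₀
  have ha₀0 : a₀.coeff 0 = α := by
    have h1 := hamod α hαR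
    rw [X_dvd_iff, coeff_sub, coeff_C_zero, sub_eq_zero] at h1
    rw [ha₀, coeff_map, h1, hφ, MvPolynomial.eval_C]
  have hroot0' : (X : E[X]) ^ (2 * κ) ∣ χ₀.eval a₀ := by
    have := map_dvd (mapRingHom φ) (haroot α hαR)
    rw [coe_mapRingHom, Polynomial.map_pow, map_X, ← map_mapRingHom_eval_map] at this
    exact this
  rw [hPQ, eval_mul] at hroot0'
  -- `Y ∤ Q(a₀)` since `Q(a₀)(0) = Q(X,0)(α) ≠ 0`
  have hQndvd : ¬ (X : E[X]) ∣ Q.eval a₀ := by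
    rw [X_dvd_iff, coeff_zero_eval_eq, ha₀0]
    exact hαQ
  have hPdvd : (X : E[X]) ^ (2 * κ) ∣ P.eval a₀ :=
    prime_X.pow_dvd_of_dvd_mul_right _ hQndvd hroot0'
  have hPdvd' : (X : E[X]) ^ κ ∣ P.eval a₀ := (pow_dvd_pow _ (by omega)).trans hPdvd
  exact hP0 (hΥinj α hαR γ (hγ' α hαR) P hPdeg hPc hPdvd')

end Literature.NumberTheory.DiophantineGeometry
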